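import Summits.Ventures.PercRepro.RankLevelSetAbsorbStarNullity
import Summits.Ventures.PercRepro.RankLevelSetAbsorbNormClass

/-! # RankLevelSetStarPlusNullity — (★★)⁺ AT EVERY LEVEL, HENCE (ABS-norm), ON EVERY SIMPLE COLOOP-FREE MATROID OF
NULLITY AT MOST `3` (night-1 g36; dossier §48.15; on `RankLevelSetAbsorbStarNullity` and `RankLevelSetAbsorbNormClass`)

The reflection `A^y_i ≤ A^y_{#E − i}` is per circuit: the members of `K` at level `i` inject into the hyperplane
family `ℱ(i − s)` (`members_le_fam`), the family `ℱ(#E − i − s)` injects into the members of `K` at level `#E − i`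
(`fam_le_absorb`), and the up-shadow chain from `i − s` to `#E − i − s` closes (`le_of_chain`) exactly when
`s ≥ ρ`, the dual rank of the hyperplane `H = E ∖ K` — always for `rk M✶ ≤ 3` (`ρ ≤ 2 ≤ s`), with the steps valid
for `3 ≤ i` (**`starPlus_perCircuit_of_nullity`**). Summing over the circuits (**`absorb_le_of_perCircuit_levels`**)
gives **`starPlus_of_nullity`** and, with the levels `≤ 2`, **`biIndepStarPlus_of_simple_coloopFree_of_nullity`**;
with (ABS-star) of the same class (`biIndepAbsorbStar_of_simple_coloopFree_of_nullity`) and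
`absorbNormSkew_of_absorbStar` this is **`absorbNormSkew_of_simple_coloopFree_of_nullity`**: (ABS-norm) holds on
every loopless matroid without parallel pairs and coloops whose dual has rank `≤ 3`. Every declaration has a
docstring; imports: the cell's own modules and Mathlib only. Axioms: standard. -/

namespace PercRepro

open Set Matroid

variable {α : Type} (M : Matroid α) [M.Finite]

/-! ## The fiberwise sum between two levels -/

/-- **A per-circuit inequality between two absorbing levels sums to the levels**: if
`#members(K, k) ≤ #members(K, k')` for every circuit class `K` of the absorbing `k`-sets, then `A^y_k ≤ A^y_{k'}`
(the circuits not met at level `k` only add members at level `k'`). -/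
lemma absorb_le_of_perCircuit_levels {y : α} (k k' : ℕ)
    (hK : ∀ Z₀ ∈ lowAbsorbAt M y k,
      {Z ∈ lowAbsorbAt M y k | M.fundCircuit y Z = M.fundCircuit y Z₀}.ncard ≤
        {Z ∈ lowAbsorbAt M y k' | M.fundCircuit y Z = M.fundCircuit y Z₀}.ncard) :
    (lowAbsorbAt M y k).ncard ≤ (lowAbsorbAt M y k').ncard := by
  classical
  set f : Set α → Set α := fun Z => M.fundCircuit y Z with hf
  have hmfin : (lowAbsorbAt M y k).Finite := lowAbsorbAt_finite M y k
  have htfin : (lowAbsorbAt M y k').Finite := lowAbsorbAt_finite M y k'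
  set A := hmfin.toFinset with hA
  set B := htfin.toFinset with hB
  have hcardA : ∀ K, (A.filter (fun Z => f Z = K)).card = {Z ∈ lowAbsorbAt M y k | f Z = K}.ncard := by
    intro K
    rw [← Set.ncard_coe_finset, Finset.coe_filter]
    congr 1
    ext Z
    simp only [Set.mem_setOf_eq, hA, Set.Finite.mem_toFinset]
  have hcardB : ∀ K, (B.filter (fun Z => f Z = K)).card =
      {Z ∈ lowAbsorbAt M y k' | f Z = K}.ncard := by
    intro K
    rw [← Set.ncard_coe_finset, Finset.coe_filter]
    congr 1
    ext Z
    simp only [Set.mem_setOf_eq, hB, Set.Finite.mem_toFinset]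
  have h1 : A.card = ∑ K ∈ A.image f, (A.filter (fun Z => f Z = K)).card :=
    Finset.card_eq_sum_card_image f A
  have h2 : (B.filter (fun Q => f Q ∈ A.image f)).card =
      ∑ K ∈ A.image f, ((B.filter (fun Q => f Q ∈ A.image f)).filter (fun Q => f Q = K)).card :=
    Finset.card_eq_sum_card_fiberwise (fun Q hQ => (Finset.mem_filter.mp hQ).2)
  have h3 : ∀ K ∈ A.image f, (A.filter (fun Z => f Z = K)).card ≤
      ((B.filter (fun Q => f Q ∈ A.image f)).filter (fun Q => f Q = K)).card := by
    intro K hK'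
    obtain ⟨Z₀, hZ₀A, rfl⟩ := Finset.mem_image.mp hK'
    have hZ₀ : Z₀ ∈ lowAbsorbAt M y k := hmfin.mem_toFinset.mp hZ₀A
    have hsub : B.filter (fun Q => f Q = f Z₀) ⊆
        (B.filter (fun Q => f Q ∈ A.image f)).filter (fun Q => f Q = f Z₀) := by
      intro Q hQ
      rw [Finset.mem_filter] at hQ
      rw [Finset.mem_filter, Finset.mem_filter]
      exact ⟨⟨hQ.1, hQ.2 ▸ hK'⟩, hQ.2⟩
    calc (A.filter (fun Z => f Z = f Z₀)).card
        = {Z ∈ lowAbsorbAt M y k | f Z = f Z₀}.ncard := hcardA _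
      _ ≤ {Z ∈ lowAbsorbAt M y k' | f Z = f Z₀}.ncard := hK Z₀ hZ₀
      _ = (B.filter (fun Q => f Q = f Z₀)).card := (hcardB _).symm
      _ ≤ _ := Finset.card_le_card hsub
  have h4 : (B.filter (fun Q => f Q ∈ A.image f)).card ≤ B.card :=
    Finset.card_le_card (Finset.filter_subset _ _)
  have h5 : A.card ≤ B.card := by
    rw [h1]
    refine le_trans (Finset.sum_le_sum h3) ?_
    rw [← h2]
    exact h4
  rw [Set.ncard_eq_toFinset_card _ hmfin, Set.ncard_eq_toFinset_card _ htfin]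
  exact h5

/-! ## The per-circuit reflection under a nullity bound -/

/-- **THE PER-CIRCUIT REFLECTION WHEN `rk M✶ ≤ 3`** (coloop-free `M`, `y` in no parallel pair, `3 ≤ i`, `2i < #E`):
`#members(K, i) ≤ #members(K, #E − i)` — the up-shadow chain from `i − s` to `#E − i − s` with `ρ = 2 ≤ s`. -/
theorem starPlus_perCircuit_of_nullity (hcol : ∀ e, ¬ M.IsColoop e) {y : α} (hy : y ∈ M.E)
    (hnp : ∀ z, z ≠ y → y ∉ M.closure {z}) (hν : M✶.eRank ≤ 3) {i : ℕ} (hi3 : 3 ≤ i)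
    (hn : 2 * i < M.E.ncard) {Z₀ : Set α} (hZ₀ : Z₀ ∈ lowAbsorbAt M y i) :
    {Z ∈ lowAbsorbAt M y i | M.fundCircuit y Z = M.fundCircuit y Z₀}.ncard ≤
      {Z ∈ lowAbsorbAt M y (M.E.ncard - i) | M.fundCircuit y Z = M.fundCircuit y Z₀}.ncard := by
  obtain ⟨hKeq, hSZ, hSE, hHE, -, -, hHy, hyH, hnl, -⟩ := circuit_dual_facts M hcol hy hZ₀
  have h1 := members_le_fam M hy hZ₀
  have h2 := fam_le_absorb M hy hZ₀ (M.E.ncard - i - (M.fundCircuit y Z₀ \ {y}).ncard)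
  obtain ⟨z₀, hz₀⟩ : (M.E \ {y}).Nonempty := by
    rw [← Set.ncard_pos (M.ground_finite.subset Set.sdiff_subset), Set.ncard_sdiff_singleton_of_mem hy]
    omega
  have hz₀y : z₀ ≠ y := by simpa using hz₀.2
  have hK3 := (fundCircuit_ncard_absorb M hy hnp hz₀y hZ₀).1
  have hZE : Z₀ ⊆ M.E := hZ₀.1.1
  have hZi : Z₀.ncard = i := hZ₀.1.2.1
  set K := M.fundCircuit y Z₀ with hK'
  set S := K \ {y} with hS
  set H := M.E \ K with hH
  have hyK : y ∈ K := M.mem_fundCircuit y Z₀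
  have hKE : K ⊆ M.E := hKeq ▸ Set.insert_subset hy hSE
  have hKfin : K.Finite := M.ground_finite.subset hKE
  have hKcard : K.ncard = S.ncard + 1 := by
    rw [hS, Set.ncard_sdiff_singleton_of_mem hyK]
    have : 1 ≤ K.ncard := (Set.ncard_pos hKfin).mpr ⟨y, hyK⟩
    omega
  have hKle : K.ncard ≤ M.E.ncard := Set.ncard_le_ncard hKE M.ground_finite
  have hHcard : H.ncard + K.ncard = M.E.ncard := by
    rw [hH, Set.ncard_sdiff hKE hKfin]; omega
  have hsi : S.ncard ≤ i := by
    rw [← hZi]; exact Set.ncard_le_ncard hSZ (M.ground_finite.subset hZE)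
  have hyE' : y ∈ M✶.E := by rwa [Matroid.dual_ground]
  have hHE' : H ⊆ M✶.E := by rwa [Matroid.dual_ground]
  have hSE' : S ⊆ M✶.E := by rwa [Matroid.dual_ground]
  have hρ : M✶.eRk H ≤ ((2 : ℕ) : ℕ∞) := by
    have h : M✶.eRk H + 1 ≤ ((2 : ℕ) : ℕ∞) + 1 := by
      rw [eRk_add_one_eq_eRank_of_spanning_insert hyE' hyH hHy]
      exact hν
    exact (WithTop.add_le_add_iff_right (by decide)).mp h
  have hs2 : 2 ≤ S.ncard := by omega
  set f : ℕ → ℕ := fun j =>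
    {X | X ⊆ H ∧ X.ncard = j ∧ M✶.Spanning (S ∪ X) ∧ M✶.Spanning (insert y (H \ X))}.ncard with hf
  have hchain : f (i - S.ncard) ≤ f (M.E.ncard - i - S.ncard) := by
    have hm : M.E.ncard - i - S.ncard = (i - S.ncard) + (M.E.ncard - 2 * i) := by omega
    rw [hm]
    refine le_of_chain f (c := M.E.ncard - i - 2) (by omega) ?_
    intro t ht
    have hstep := absorbFam_step (S := S) hHE' hSE' hyE' hyH hHy hnl hρ (by norm_num)
      (i := i - S.ncard + t) (by omega)
    have e1 : H.ncard - (i - S.ncard + t) - (2 - 1) = M.E.ncard - i - 2 - t := by omega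
    rw [e1] at hstep
    exact hstep
  have e2 : M.E.ncard - i - S.ncard + S.ncard = M.E.ncard - i := by omega
  rw [e2] at h2
  calc {Z ∈ lowAbsorbAt M y i | M.fundCircuit y Z = M.fundCircuit y Z₀}.ncard ≤ f (i - S.ncard) := h1
    _ ≤ f (M.E.ncard - i - S.ncard) := hchain
    _ ≤ _ := h2

/-- **(★★)⁺ AT EVERY LEVEL `i ≥ 3` ON A COLOOP-FREE MATROID OF NULLITY `≤ 3` AT AN ELEMENT IN NO PARALLEL PAIR**
(`2i < #E`): `A^y_i ≤ A^y_{#E − i}`. -/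
theorem starPlus_of_nullity (hcol : ∀ e, ¬ M.IsColoop e) {y : α} (hy : y ∈ M.E)
    (hnp : ∀ z, z ≠ y → y ∉ M.closure {z}) (hν : M✶.eRank ≤ 3) {i : ℕ} (hi3 : 3 ≤ i)
    (hn : 2 * i < M.E.ncard) : lowAbsorbCount M y i ≤ lowAbsorbCount M y (M.E.ncard - i) := by
  unfold lowAbsorbCount
  exact absorb_le_of_perCircuit_levels M i (M.E.ncard - i)
    (fun Z₀ hZ₀ => starPlus_perCircuit_of_nullity M hcol hy hnp hν hi3 hn hZ₀)

/-! ## The class theorems -/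

/-- **(★★)⁺ HOLDS ON EVERY LOOPLESS MATROID WITHOUT PARALLEL PAIRS AND COLOOPS WHOSE DUAL HAS RANK `≤ 3`**
(nullity `≤ 3`): the levels `≤ 2` are `starPlus_of_le_two`, the levels `≥ 3` the per-circuit chain. -/
theorem biIndepStarPlus_of_simple_coloopFree_of_nullity (hl : ∀ e, ¬ M.IsLoop e)
    (hp : ∀ u v, ¬ ParallelPair M u v) (hcol : ∀ e, ¬ M.IsColoop e) (hν : M✶.eRank ≤ 3) :
    BiIndepStarPlus M := by
  intro y hy i hi
  rcases Nat.lt_or_ge i 3 with h2 | h3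
  · exact starPlus_of_le_two M hy (by omega) hi
  · exact starPlus_of_nullity M hcol hy
      (fun _ hz => notMem_closure_singleton_of_no_partner M hy (hl y) (hp y) hz) hν h3 hi

/-- **(ABS-norm) HOLDS ON EVERY LOOPLESS MATROID WITHOUT PARALLEL PAIRS AND COLOOPS WHOSE DUAL HAS RANK `≤ 3`**:
(ABS-star) and (★★)⁺ of the class through `absorbNormSkew_of_absorbStar`. -/
theorem absorbNormSkew_of_simple_coloopFree_of_nullity [DecidableEq α] (hl : ∀ e, ¬ M.IsLoop e)
    (hp : ∀ u v, ¬ ParallelPair M u v) (hcol : ∀ e, ¬ M.IsColoop e) (hν : M✶.eRank ≤ 3) :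
    BiIndepAbsorbNormSkew M :=
  absorbNormSkew_of_absorbStar M (biIndepAbsorbStar_of_simple_coloopFree_of_nullity M hl hp hcol hν)
    (biIndepStarPlus_of_simple_coloopFree_of_nullity M hl hp hcol hν)

end PercRepro
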